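import Literature.AlgebraicGeometry.AbelianVarieties.PoincareSheafUniversalOfNormal
import HarnessLib

/-!
# The seesaw graph condition and the seesaw sheaf of a family (M13 programme, node P0: plumbing)

Layer `Literature/AlgebraicGeometry/Motives` ∩ `AbelianVarieties`, namespace `Literature.AlgebraicGeometry.Motives.AbelianVariety`.
Non-`Prop` plumbing DEFINITIONS + their bookkeeping theorems; no named fact, no instance, no `sorry` (cell `hodgecm-mathlib`,
programme M13, SPEC = B-p12's probe v0.4 §1, whose texts these are, token-unchanged).  For a complex abelian variety `A₀`,
`Â = A₀/K(Θ)`, a sheaf `𝒫` on `A₀ × Â`, a `ℂ`-scheme `T` and a rigidified line bundle `ℒ` on `A₀ × T`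
([MumfordAV1970] §13, proof of the Thm. p. 125: «`Γ(S) = {g : S → X̂ ; (1 × g)^*P ≅ L_S}`»; [MilneAV2008] I §8):

* `restrictAlong T' u` — `1_{A₀} × u₁ : A₀ × S → A₀ × T` for a test morphism `u = (u₁, u₂) : S → T × Â`;
  `restrictAlong_eq_whiskerLeft_left` (`= A₀ ◁ u₁`), `restrictAlong_lift_eq`, `restrictAlong_lift_id`;
* `GraphCond u` — «`(1 × u₂)^*𝒫 ≅ (1 × u₁)^*ℒ` on `A₀ × S`», the functor of points of the seesaw graph;
* `seesawSheaf` — `𝓕 = q₁₂^*ℒ ⊗ (q₁₃^*𝒫)^∨` on `A₀ × (T × Â)` (★ `hasRank_seesawSheaf` currency).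
(The SPEC's dual-number carriers `dualNumberOver` / `dualNumberPoint` live in `Motives/DualNumberPoints`, B-plan1 R111.)

HC_CM is proved only modulo the 7 printed citations until rung 0 closes.

## References
* [MumfordAV1970] D. Mumford, *Abelian Varieties* (1970), §10 (p. 89), §13 (p. 125).
* [MilneAV2008] J. S. Milne, *Abelian Varieties* (2008), I §8 (pp. 36–37).
-/

noncomputable section

open CategoryTheory CategoryTheory.Limits AlgebraicGeometry MonoidalCategory CartesianMonoidalCategory

namespace Literature.AlgebraicGeometry.Motives.AbelianVariety

open Literature.AlgebraicGeometry.AbelianSchemes Literature.AlgebraicGeometry.AbelianVarieties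
  Literature.AlgebraicGeometry.Modules

section M13

variable (A₀ : AbelianVariety ℂ) {Θ : CartierDivisor A₀.X.left} (hΘ : Θ.IsAmple)
  (P : (A₀.X ⊗ (A₀.dualOf Θ hΘ).X).left.Modules)
  (T' : SchemeOver ℂ) (ℒ : (AbelianSchemeOver.ofAbelianVariety A₀).RigidifiedLineBundle T'.hom)

/-- `1_{A₀} × u₁ : A₀ × S → A₀ × T` for a test morphism `u = (u₁, u₂) : S → T × Â` over `ℂ` (the map along
which `ℒ` is restricted to the test scheme). Non-Prop plumbing. [cite: MilneAV2008, I §8 pp. 36–37] -/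
def restrictAlong {S : SchemeOver ℂ} (u : S ⟶ T' ⊗ (A₀.dualOf Θ hΘ).X) :
    pullback A₀.X.hom S.hom ⟶ pullback A₀.X.hom T'.hom :=
  pullback.lift (pullback.fst _ _) (pullback.snd _ _ ≫ (u ≫ CartesianMonoidalCategory.fst _ _).left) (by
    rw [pullback.condition, Category.assoc]
    congr 1
    exact (Over.w (u ≫ CartesianMonoidalCategory.fst _ _)).symm)

/-- **The graph condition** of a test morphism `u = (u₁, u₂) : S → T × Â` over `ℂ`:
«`(1_{A₀} × u₂)^*𝒫 ≅ (1_{A₀} × u₁)^*ℒ` on `A₀ × S`» — the would-be functor of points of the seesaw graph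
`Γ` ([MumfordAV1970] §10 p. 89 / §13 p. 125: `Γ(S) = {g : S → X̂ ; (1 × g)^*P ≅ L_S}`; rigidifications on
both sides make the base twist `𝓜` trivial).  Non-Prop plumbing. [cite: MumfordAV1970, §13 (proof of the Thm. p. 125)] -/
def GraphCond {S : SchemeOver ℂ} (u : S ⟶ T' ⊗ (A₀.dualOf Θ hΘ).X) : Prop :=
  Nonempty
    ((Scheme.Modules.pullback ((AbelianSchemeOver.ofAbelianVariety A₀).baseChangeToProd
        (AbelianSchemeOver.ofAbelianVariety (A₀.dualOf Θ hΘ)) S.hom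
        (u ≫ CartesianMonoidalCategory.snd _ _).left
        (Over.w (u ≫ CartesianMonoidalCategory.snd _ _)))).obj P ≅
      (Scheme.Modules.pullback (restrictAlong A₀ hΘ T' u)).obj ℒ.L)

/-- **The seesaw sheaf** `𝓕 := q₁₂^*ℒ ⊗ (q₁₃^*𝒫)^∨` on `A₀ × (T × Â)` (★ `hasRank_seesawSheaf` currency of
★ `exists_unique_classify_of_normal`, S1). Non-Prop plumbing. [cite: MumfordAV1970, §10 (p. 89)] -/
def seesawSheaf : (A₀.X ⊗ (T' ⊗ (A₀.dualOf Θ hΘ).X)).left.Modules :=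
  tensorObj
    ((Scheme.Modules.pullback
      (A₀.X ◁ CartesianMonoidalCategory.fst T' (A₀.dualOf Θ hΘ).X).left).obj ℒ.L)
    (Modules.dual ((Scheme.Modules.pullback
      (A₀.X ◁ CartesianMonoidalCategory.snd T' (A₀.dualOf Θ hΘ).X).left).obj P))

end M13

section Bookkeeping

variable (A₀ : AbelianVariety ℂ) {Θ : CartierDivisor A₀.X.left} (hΘ : Θ.IsAmple)
  (T' : SchemeOver ℂ)

/-- **`restrictAlong u = A₀ ◁ u₁`**: the restriction map of a test pair is the cartesian-monoidal whiskering of its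
`T`-coordinate (both have the projections `pr_{A₀}` and `pr_S ≫ u₁`; cf. ★ `AbelianSchemeOver.baseChangeToProd_eq_whiskerLeft_left`).
[cite: MilneAV2008, I §8 pp. 36–37] -/
theorem restrictAlong_eq_whiskerLeft_left {S : SchemeOver ℂ} (u : S ⟶ T' ⊗ (A₀.dualOf Θ hΘ).X) :
    restrictAlong A₀ hΘ T' u = (A₀.X ◁ (u ≫ CartesianMonoidalCategory.fst _ _)).left := by
  unfold restrictAlong
  apply pullback.hom_ext
  · rw [pullback.lift_fst]
    exact (Over.whiskerLeft_left_fst (R := A₀.X) (u ≫ CartesianMonoidalCategory.fst _ _)).symm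
  · rw [pullback.lift_snd]
    exact (Over.whiskerLeft_left_snd (R := A₀.X) (u ≫ CartesianMonoidalCategory.fst _ _)).symm

/-- The restriction map of a test pair depends only on its `T`-coordinate: `restrictAlong (x, y) = restrictAlong (x, y')`.
[cite: MilneAV2008, I §8 pp. 36–37] -/
theorem restrictAlong_lift_eq {S : SchemeOver ℂ} (x : S ⟶ T') (y y' : S ⟶ (A₀.dualOf Θ hΘ).X) :
    restrictAlong A₀ hΘ T' (CartesianMonoidalCategory.lift x y) =
      restrictAlong A₀ hΘ T' (CartesianMonoidalCategory.lift x y') := by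
  unfold restrictAlong
  apply pullback.hom_ext
  · rw [pullback.lift_fst, pullback.lift_fst]
  · rw [pullback.lift_snd, pullback.lift_snd, CartesianMonoidalCategory.lift_fst, CartesianMonoidalCategory.lift_fst]

/-- Along the section `(1, s) : T → T × Â` the restriction map `A₀ × T → A₀ × T` of `ℒ` is the identity.
[cite: MilneAV2008, I §8 pp. 36–37] -/
theorem restrictAlong_lift_id (s : T' ⟶ (A₀.dualOf Θ hΘ).X) :
    restrictAlong A₀ hΘ T' (CartesianMonoidalCategory.lift (𝟙 _) s) = 𝟙 _ := by
  unfold restrictAlong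
  apply pullback.hom_ext
  · rw [pullback.lift_fst, Category.id_comp]
  · rw [pullback.lift_snd, Category.id_comp, CartesianMonoidalCategory.lift_fst, Over.id_left, Category.comp_id]

end Bookkeeping

end Literature.AlgebraicGeometry.Motives.AbelianVariety

end
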